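import Literature.Computability.AlgebraicComplexity.GrenetEquivariant

/-!
# Route RigidityForcesSymmetry — `GrenetFirstOrderRankRigid` (item stmt-ValiantsHypothesis-21029),
line `grenet_gauge`: stub `stub_constGauge` (degree-zero part of the tangency identity and the
corank-one gauge lemma, trace-balanced)

For the crux line `Cruxes/GrenetFirstOrderRankRigid/Lines/grenet_gauge.lean`.  If a direction
`(Λ', A')` is Zariski-tangent to `{det = per_n}` at Grenet's pencil `Λ + Σ_v x_v A_v`, i.e.
`tr(adj(Λ + Σ x_v A_v) · (Λ' + Σ x_v A'_v)) = 0` as a polynomial, then its constant part `Λ'` is a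
TRACE-BALANCED GAUGE DIRECTION: `Λ' = P Λ - Λ Q` with `tr P = tr Q`.

Proof.
1. `MvPolynomial.constantCoeff` is a ring morphism, so the constant term of the identity is
   `tr(adj Λ · Λ') = 0` (`RingHom.map_adjugate`, `AddMonoidHom.map_trace`).
2. Grenet's constant part `Λ = (coeff 0 ∘ Grenet.repr k n e)` is `ε · [R i = C j]` with `ε = ±1`,
   `R i ≠ univ` the vertex of row `i` and `C j ≠ ∅` the vertex of column `j`: a signed PARTIAL
   PERMUTATION matrix with exactly one zero row `i₀` (`R i₀ = ∅`) and one zero column `j₀`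
   (`C j₀ = univ`); equivalently `Λᵀ Λ = 1 - E_{j₀ j₀}`, `Λ Λᵀ = 1 - E_{i₀ i₀}`.
3. For such a matrix every cofactor vanishes except the `(j₀, i₀)` one, whose square is `1`
   (`B Bᵀ = 1` for `B = Λ` with row `i₀` replaced by `e_{j₀}`), so `tr(adj Λ · Λ') = ± Λ'_{i₀ j₀}` and
   the tangency gives `Λ'_{i₀ j₀} = 0`.
4. Then `P = Λ' Λᵀ + t E_{i₀ i₀}`, `Q = -Λᵀ Λ' E_{j₀ j₀}` satisfy `P Λ - Λ Q = Λ' - E_{i₀ i₀} Λ' E_{j₀ j₀}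
   = Λ'`, and `t` balances the traces (`E_{i₀ i₀} Λ = 0`).

Main statements: `constantCoeff_trace_adjugate_pencil_mul` (step 1, any pencil),
`exists_traceBalanced_gauge_of_trace_adjugate_mul_eq_zero` (steps 3–4, any commutative ring),
`transpose_mul_self_of_signedMatching` (step 2, abstract), `coeff_zero_grenet_repr`,
`grenet_constGauge` (the line's `stub_constGauge` for every vertex enumeration `e` and any pencil
with Grenet's constant part; the line takes `e = enumSubsets n`, `Λ = gΛ n`, `A = gA n` and closes
its stub by `exact grenet_constGauge (enumSubsets n) _ (fun _ _ => rfl) (gA n) Λ' A' htr`).  No new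
definitions.  VP ≠ VNP is not moved by this
file (first-order bookkeeping about one explicit matrix family).
-/

noncomputable section

open MvPolynomial Matrix Finset

namespace Summit.ValiantsHypothesis.Theorems.RigidityForcesSymmetry.GrenetGauge

open Literature.Computability.AlgebraicComplexity

/-! ### 1. The degree-zero component of the tangency identity -/

section ConstantTerm

variable {k : Type*} [CommRing k] {σ ι : Type*} [Fintype σ]

/-- The constant part of an affine pencil `Λ + Σ_v x_v A_v` is `Λ`. [folklore] -/
theorem map_constantCoeff_pencil (Λ : Matrix ι ι k) (A : σ → Matrix ι ι k) :
    (Λ.map (C : k →+* MvPolynomial σ k) + ∑ v, (X v : MvPolynomial σ k) • (A v).map C).map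
        (constantCoeff : MvPolynomial σ k →+* k) = Λ := by
  refine Matrix.ext fun i j => ?_
  simp [Matrix.map_apply, Matrix.add_apply, Matrix.sum_apply, Matrix.smul_apply, smul_eq_mul,
    constantCoeff_C, constantCoeff_X]

variable [Fintype ι] [DecidableEq ι]

/-- **Degree-zero component of the Jacobi tangency identity**: the constant term of
`tr(adj(Λ + Σ x_v A_v) · (Λ' + Σ x_v A'_v))` is `tr(adj Λ · Λ')` (`constantCoeff` is a ring
morphism and commutes with adjugates and traces). [folklore] -/
theorem constantCoeff_trace_adjugate_pencil_mul (Λ Λ' : Matrix ι ι k) (A A' : σ → Matrix ι ι k) :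
    constantCoeff (((Λ.map (C : k →+* MvPolynomial σ k) + ∑ v, (X v : MvPolynomial σ k) • (A v).map C).adjugate
        * (Λ'.map (C : k →+* MvPolynomial σ k) + ∑ v, (X v : MvPolynomial σ k) • (A' v).map C)).trace)
      = (Λ.adjugate * Λ').trace := by
  rw [AddMonoidHom.map_trace (constantCoeff : MvPolynomial σ k →+* k), Matrix.map_mul,
    ← RingHom.mapMatrix_apply (constantCoeff : MvPolynomial σ k →+* k), RingHom.map_adjugate,
    RingHom.mapMatrix_apply, map_constantCoeff_pencil, map_constantCoeff_pencil]

end ConstantTerm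

/-! ### 2. The corank-one gauge lemma for a signed partial permutation matrix -/

section Gauge

variable {R : Type*} [CommRing R] {ι : Type*} [Fintype ι] [DecidableEq ι]

/-- If row `i₀` and column `j₀` of `G` vanish, then `tr(adj G · Λ') = c · Λ'_{i₀ j₀}` with `c` the
`(j₀, i₀)` cofactor (every other cofactor has a zero row or a zero column). [folklore] -/
theorem trace_adjugate_mul_of_row_col_zero (G Λ' : Matrix ι ι R) (i₀ j₀ : ι)
    (hrow : ∀ k, G i₀ k = 0) (hcol : ∀ k, G k j₀ = 0) :
    (G.adjugate * Λ').trace = (G.updateRow i₀ (Pi.single j₀ 1)).det * Λ' i₀ j₀ := by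
  have hb : ∀ a b, b ≠ i₀ → (G.updateRow b (Pi.single a (1 : R))).det = 0 := fun a b hb =>
    det_eq_zero_of_row_eq_zero i₀ fun k => by rw [updateRow_ne (Ne.symm hb), hrow]
  have ha : ∀ a, a ≠ j₀ → (G.updateRow i₀ (Pi.single a (1 : R))).det = 0 := fun a ha =>
    det_eq_zero_of_column_eq_zero j₀ fun i => by
      by_cases hi : i = i₀
      · subst hi
        rw [updateRow_self, Pi.single_eq_of_ne (Ne.symm ha)]
      · rw [updateRow_ne hi, hcol]
  simp only [Matrix.trace, Matrix.diag, Matrix.mul_apply, Matrix.adjugate_apply]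
  have h1 : ∀ a, a ≠ j₀ → ∑ b, (G.updateRow b (Pi.single a (1 : R))).det * Λ' b a = 0 := by
    intro a ha'
    refine Finset.sum_eq_zero fun b _ => ?_
    by_cases hb' : b = i₀
    · subst hb'
      rw [ha a ha', zero_mul]
    · rw [hb a b hb', zero_mul]
  rw [Fintype.sum_eq_single j₀ h1,
    Fintype.sum_eq_single i₀ fun b hb' => by rw [hb j₀ b hb', zero_mul]]

/-- If column `j₀` of `G` vanishes and `G Gᵀ = 1 - E_{i₀ i₀}`, then `G` with row `i₀` replaced by
`e_{j₀}` is orthogonal: `B Bᵀ = 1`. [folklore] -/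
theorem updateRow_mul_transpose_eq_one (G : Matrix ι ι R) (i₀ j₀ : ι) (hcol : ∀ k, G k j₀ = 0)
    (hGGt : G * Gᵀ = 1 - Matrix.single i₀ i₀ 1) :
    G.updateRow i₀ (Pi.single j₀ 1) * (G.updateRow i₀ (Pi.single j₀ 1))ᵀ = 1 := by
  have hG : ∀ a a', ∑ x, G a x * G a' x = (1 - Matrix.single i₀ i₀ (1 : R)) a a' := fun a a' => by
    rw [← hGGt, Matrix.mul_apply]
    rfl
  refine Matrix.ext fun a a' => ?_
  rw [Matrix.mul_apply]
  simp only [Matrix.transpose_apply]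
  by_cases ha : a = i₀
  · subst ha
    simp only [updateRow_self]
    by_cases ha' : a' = a
    · subst ha'
      rw [updateRow_self, Matrix.one_apply_eq,
        Fintype.sum_eq_single j₀ fun x hx => by rw [Pi.single_eq_of_ne hx, zero_mul]]
      simp
    · rw [updateRow_ne ha', Matrix.one_apply_ne (Ne.symm ha'),
        Fintype.sum_eq_single j₀ fun x hx => by rw [Pi.single_eq_of_ne hx, zero_mul], hcol, mul_zero]
  · rw [updateRow_ne ha]
    by_cases ha' : a' = i₀
    · subst ha'
      rw [updateRow_self, Matrix.one_apply_ne ha,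
        Fintype.sum_eq_single j₀ fun x hx => by rw [Pi.single_eq_of_ne hx, mul_zero], hcol, zero_mul]
    · rw [updateRow_ne ha', hG, Matrix.sub_apply,
        Matrix.single_apply_of_ne (h := fun h => ha h.1.symm), sub_zero]

/-- **Gauge construction** for a signed partial permutation matrix `G` with zero row `i₀` and zero
column `j₀` (`Gᵀ G = 1 - E_{j₀ j₀}`, `G Gᵀ = 1 - E_{i₀ i₀}`): every `Λ'` with `Λ'_{i₀ j₀} = 0` is a
trace-balanced gauge direction `P G - G Q`, `tr P = tr Q` — take `P = Λ' Gᵀ + t E_{i₀ i₀}`,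
`Q = -Gᵀ Λ' E_{j₀ j₀}`. [folklore] -/
theorem exists_traceBalanced_gauge (G Λ' : Matrix ι ι R) (i₀ j₀ : ι) (hrow : ∀ k, G i₀ k = 0)
    (hGtG : Gᵀ * G = 1 - Matrix.single j₀ j₀ 1) (hGGt : G * Gᵀ = 1 - Matrix.single i₀ i₀ 1)
    (h0 : Λ' i₀ j₀ = 0) :
    ∃ P Q : Matrix ι ι R, P.trace = Q.trace ∧ Λ' = P * G - G * Q := by
  refine ⟨Λ' * Gᵀ + Matrix.single i₀ i₀ ((-(Gᵀ * Λ' * Matrix.single j₀ j₀ 1)).trace - (Λ' * Gᵀ).trace),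
    -(Gᵀ * Λ' * Matrix.single j₀ j₀ 1), ?_, ?_⟩
  · rw [Matrix.trace_add, Matrix.trace_single_eq_same]
    ring
  · have hS : ∀ t : R, Matrix.single i₀ i₀ t * G = 0 := fun t => by
      refine Matrix.ext fun a b => ?_
      rw [Matrix.zero_apply]
      by_cases ha : a = i₀
      · subst ha
        rw [Matrix.single_mul_apply_same, hrow, mul_zero]
      · rw [Matrix.single_mul_apply_of_ne (h := ha)]
    have h1 : ∀ t : R, (Λ' * Gᵀ + Matrix.single i₀ i₀ t) * G - G * -(Gᵀ * Λ' * Matrix.single j₀ j₀ 1)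
        = Λ' * (Gᵀ * G) + Matrix.single i₀ i₀ t * G + G * Gᵀ * Λ' * Matrix.single j₀ j₀ 1 := by
      intro t
      noncomm_ring
    rw [h1, hS, hGtG, hGGt]
    have h2 : Λ' * (1 - Matrix.single j₀ j₀ (1 : R)) + 0
          + (1 - Matrix.single i₀ i₀ 1) * Λ' * Matrix.single j₀ j₀ 1
        = Λ' - Matrix.single i₀ i₀ 1 * Λ' * Matrix.single j₀ j₀ 1 := by
      noncomm_ring
    rw [h2, Matrix.single_mul_mul_single, h0]
    simp

/-- **Corank-one gauge lemma, trace-balanced.** For a signed partial permutation matrix `G` with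
exactly one zero row `i₀` and one zero column `j₀`: if `tr(adj G · Λ') = 0` then
`Λ' = P G - G Q` with `tr P = tr Q` (the `(j₀, i₀)` cofactor is a unit since `B Bᵀ = 1`, so the
tangency reads `Λ'_{i₀ j₀} = 0`). [folklore] -/
theorem exists_traceBalanced_gauge_of_trace_adjugate_mul_eq_zero (G Λ' : Matrix ι ι R) (i₀ j₀ : ι)
    (hrow : ∀ k, G i₀ k = 0) (hcol : ∀ k, G k j₀ = 0)
    (hGtG : Gᵀ * G = 1 - Matrix.single j₀ j₀ 1) (hGGt : G * Gᵀ = 1 - Matrix.single i₀ i₀ 1)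
    (htr : (G.adjugate * Λ').trace = 0) :
    ∃ P Q : Matrix ι ι R, P.trace = Q.trace ∧ Λ' = P * G - G * Q := by
  refine exists_traceBalanced_gauge G Λ' i₀ j₀ hrow hGtG hGGt ?_
  rw [trace_adjugate_mul_of_row_col_zero G Λ' i₀ j₀ hrow hcol] at htr
  have hdet : (G.updateRow i₀ (Pi.single j₀ 1)).det * (G.updateRow i₀ (Pi.single j₀ 1)).det = 1 := by
    have := congrArg Matrix.det (updateRow_mul_transpose_eq_one G i₀ j₀ hcol hGGt)
    rwa [Matrix.det_mul, Matrix.det_transpose, Matrix.det_one] at this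
  calc Λ' i₀ j₀
      = ((G.updateRow i₀ (Pi.single j₀ 1)).det * (G.updateRow i₀ (Pi.single j₀ 1)).det) * Λ' i₀ j₀ := by
        rw [hdet, one_mul]
    _ = 0 := by rw [mul_assoc, htr, mul_zero]

/-! ### 3. Signed matchings -/

/-- **`Gᵀ G` for a signed matching matrix.** If `G_{ij} = ε · [r i = c j]` with `r, c` injective,
`ε² = 1`, the value `c j₀` missed by `r` and every other `c j` hit, then `Gᵀ G = 1 - E_{j₀ j₀}`.
[folklore] -/
theorem transpose_mul_self_of_signedMatching {α : Type*} [DecidableEq α] (r c : ι → α)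
    (hr : Function.Injective r) (hc : Function.Injective c) (ε : R) (hε : ε * ε = 1) (j₀ : ι)
    (hmiss : ∀ i, r i ≠ c j₀) (hhit : ∀ j, j ≠ j₀ → ∃ i, r i = c j)
    (G : Matrix ι ι R) (hG : ∀ i j, G i j = ε * if r i = c j then 1 else 0) :
    Gᵀ * G = 1 - Matrix.single j₀ j₀ 1 := by
  refine Matrix.ext fun j j' => ?_
  rw [Matrix.mul_apply, Matrix.sub_apply, Matrix.one_apply, Matrix.single_apply]
  simp only [Matrix.transpose_apply, hG]
  by_cases hjj : j = j'
  · subst hjj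
    have hterm : ∀ i, (ε * if r i = c j then (1 : R) else 0) * (ε * if r i = c j then (1 : R) else 0)
        = if r i = c j then 1 else 0 := by
      intro i
      split_ifs
      · rw [mul_one, hε]
      · rw [mul_zero, mul_zero]
    simp only [hterm, if_true]
    by_cases hj0 : j = j₀
    · subst hj0
      rw [Finset.sum_eq_zero fun i _ => if_neg (hmiss i)]
      simp
    · obtain ⟨i₁, hi₁⟩ := hhit j hj0
      rw [Fintype.sum_eq_single i₁ fun i hi => if_neg fun h => hi (hr (h.trans hi₁.symm)),
        if_pos hi₁, if_neg fun h => hj0 h.1.symm, sub_zero]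
  · rw [if_neg hjj, if_neg fun h => hjj (h.1.symm.trans h.2), sub_zero]
    refine Finset.sum_eq_zero fun i _ => ?_
    by_cases h1 : r i = c j
    · have h2 : ¬ r i = c j' := fun h2 => hjj (hc (h1.symm.trans h2))
      rw [if_neg h2, mul_zero, mul_zero]
    · rw [if_neg h1, mul_zero, zero_mul]

/-- **`G Gᵀ` for a signed matching matrix** (the transposed statement): if `G_{ij} = ε · [r i = c j]`
with `r, c` injective, `ε² = 1`, the value `r i₀` missed by `c` and every other `r i` hit, then
`G Gᵀ = 1 - E_{i₀ i₀}`. [folklore] -/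
theorem self_mul_transpose_of_signedMatching {α : Type*} [DecidableEq α] (r c : ι → α)
    (hr : Function.Injective r) (hc : Function.Injective c) (ε : R) (hε : ε * ε = 1) (i₀ : ι)
    (hmiss : ∀ j, c j ≠ r i₀) (hhit : ∀ i, i ≠ i₀ → ∃ j, c j = r i)
    (G : Matrix ι ι R) (hG : ∀ i j, G i j = ε * if r i = c j then 1 else 0) :
    G * Gᵀ = 1 - Matrix.single i₀ i₀ 1 := by
  have hG' : ∀ j i, Gᵀ j i = ε * if c j = r i then 1 else 0 := fun j i => by
    rw [Matrix.transpose_apply, hG]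
    simp only [eq_comm]
  have h := transpose_mul_self_of_signedMatching c r hc hr ε hε i₀ hmiss hhit Gᵀ hG'
  rwa [Matrix.transpose_transpose] at h

end Gauge

/-! ### 4. Grenet's constant part is a signed partial permutation matrix -/

section Grenet

variable {k : Type*} [CommRing k] {n N : ℕ} (e : Finset (Fin n) ≃ Fin (N + 1))

/-- The arc weights of Grenet's branching program have no constant term. [cite: Grenet2011, Thm. 1] -/
theorem constantCoeff_grenet_wt (j : Fin n) (c : ℕ) : constantCoeff (Grenet.wt k n j c) = 0 := by
  unfold Grenet.wt
  split_ifs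
  · exact constantCoeff_X k _
  · exact map_zero _

/-- The adjacency matrix of Grenet's branching program has no constant term.
[cite: Grenet2011, Thm. 1] -/
theorem constantCoeff_grenet_adj (S T : Finset (Fin n)) : constantCoeff (Grenet.adj k n S T) = 0 := by
  rw [Grenet.adj_apply, map_sum]
  refine Finset.sum_eq_zero fun j _ => ?_
  split_ifs
  · exact constantCoeff_grenet_wt j _
  · exact map_zero _

/-- **Constant part of Grenet's matrix**: `coeff_0 (Grenet.repr k n e)_{ij} = ε · [R i = C j]` with the
sign `ε = (-1)^(e univ + e ∅)`, `R i = e⁻¹((e univ).succAbove i)` the vertex of row `i` and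
`C j = e⁻¹((e ∅).succAbove j)` the vertex of column `j` (the `(univ, ∅)`-minor of the identity).
[cite: Grenet2011, Thm. 1] -/
theorem coeff_zero_grenet_repr (i j : Fin N) :
    coeff 0 (Grenet.repr k n e i j) = (-1) ^ ((e univ : ℕ) + (e ∅ : ℕ)) *
      if e.symm ((e univ).succAbove i) = e.symm ((e ∅).succAbove j) then 1 else 0 := by
  show constantCoeff (Grenet.repr k n e i j) = _
  rw [Grenet.repr, Matrix.smul_apply, Matrix.submatrix_apply, Matrix.submatrix_apply, smul_eq_mul,
    map_mul, map_pow, map_neg, map_one, Matrix.sub_apply, map_sub, constantCoeff_grenet_adj,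
    sub_zero, Matrix.one_apply]
  congr 1
  split_ifs
  · exact map_one _
  · exact map_zero _

/-- The row vertices `R i` of Grenet's matrix are the proper subsets (`≠ univ`). [folklore] -/
theorem grenet_row_ne_univ (i : Fin N) : e.symm ((e univ).succAbove i) ≠ univ := fun h =>
  Fin.succAbove_ne (e univ) i (by rw [← e.apply_symm_apply ((e univ).succAbove i), h])

/-- The column vertices `C j` of Grenet's matrix are the nonempty subsets. [folklore] -/
theorem grenet_col_ne_empty (j : Fin N) : e.symm ((e ∅).succAbove j) ≠ ∅ := fun h =>
  Fin.succAbove_ne (e ∅) j (by rw [← e.apply_symm_apply ((e ∅).succAbove j), h])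

/-- Every proper subset is a row vertex. [folklore] -/
theorem exists_grenet_row_eq {S : Finset (Fin n)} (hS : S ≠ univ) :
    ∃ i : Fin N, e.symm ((e univ).succAbove i) = S := by
  obtain ⟨z, hz⟩ := Fin.exists_succAbove_eq (x := e S) (y := e univ) fun h => hS (e.injective h)
  exact ⟨z, by rw [hz, e.symm_apply_apply]⟩

/-- Every nonempty subset is a column vertex. [folklore] -/
theorem exists_grenet_col_eq {S : Finset (Fin n)} (hS : S ≠ ∅) :
    ∃ j : Fin N, e.symm ((e ∅).succAbove j) = S := by
  obtain ⟨z, hz⟩ := Fin.exists_succAbove_eq (x := e S) (y := e ∅) fun h => hS (e.injective h)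
  exact ⟨z, by rw [hz, e.symm_apply_apply]⟩

/-- **Stub `stub_constGauge` of the line `grenet_gauge`, for every vertex enumeration `e`.**  If
`(Λ', A')` is Zariski-tangent to `{det = per_n}` at an affine pencil `Λ + Σ x_v A_v` whose constant
part `Λ = coeff_0 (Grenet.repr k n e)` is Grenet's (the coefficient matrices `A_v` are arbitrary
here), i.e. `tr(adj(Λ + Σ x_v A_v) · (Λ' + Σ x_v A'_v)) = 0`, then `Λ' = P Λ - Λ Q` for some `P, Q`
with `tr P = tr Q`.  (Degree-zero component + corank-one gauge lemma: `Λ` is a signed partial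
permutation matrix whose only zero row is the row of `∅` and only zero column the column of
`univ`.)  The line instantiates `e = enumSubsets n`, `Λ = gΛ n` (`hΛ` by `rfl`), `A = gA n`.
[cite: Grenet2011, Thm. 1] -/
theorem grenet_constGauge (hn : n ≠ 0) {Λ : Matrix (Fin N) (Fin N) k}
    (hΛ : ∀ i j, Λ i j = coeff 0 (Grenet.repr k n e i j))
    (A : Fin n × Fin n → Matrix (Fin N) (Fin N) k) (Λ' : Matrix (Fin N) (Fin N) k)
    (A' : Fin n × Fin n → Matrix (Fin N) (Fin N) k)
    (htr : ((Λ.map C + ∑ v, (X v : MvPolynomial (Fin n × Fin n) k) • (A v).map C).adjugate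
        * (Λ'.map C + ∑ v, (X v : MvPolynomial (Fin n × Fin n) k) • (A' v).map C)).trace
        = (0 : MvPolynomial (Fin n × Fin n) k)) :
    ∃ P Q : Matrix (Fin N) (Fin N) k, P.trace = Q.trace ∧ Λ' = P * Λ - Λ * Q := by
  -- step 1: the constant term of the tangency identity
  have htr0 : (Λ.adjugate * Λ').trace = 0 := by
    have h := congrArg constantCoeff htr
    rwa [constantCoeff_trace_adjugate_pencil_mul, map_zero] at h
  -- step 2: the combinatorics of rows and columns
  have hne : (∅ : Finset (Fin n)) ≠ univ := fun h =>
    absurd (h.symm ▸ Finset.mem_univ (⟨0, Nat.pos_of_ne_zero hn⟩ : Fin n)) (by simp)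
  obtain ⟨i₀, hi₀⟩ := exists_grenet_row_eq e hne
  obtain ⟨j₀, hj₀⟩ := exists_grenet_col_eq e hne.symm
  have hRinj : Function.Injective fun i : Fin N => e.symm ((e univ).succAbove i) :=
    fun a b h => Fin.succAbove_right_injective (e.symm.injective h)
  have hCinj : Function.Injective fun j : Fin N => e.symm ((e ∅).succAbove j) :=
    fun a b h => Fin.succAbove_right_injective (e.symm.injective h)
  have hε : ((-1 : k) ^ ((e univ : ℕ) + (e ∅ : ℕ))) * (-1) ^ ((e univ : ℕ) + (e ∅ : ℕ)) = 1 := by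
    rw [← mul_pow, neg_one_mul, neg_neg, one_pow]
  have hG : ∀ i j, Λ i j = (-1) ^ ((e univ : ℕ) + (e ∅ : ℕ)) *
      if e.symm ((e univ).succAbove i) = e.symm ((e ∅).succAbove j) then 1 else 0 :=
    fun i j => (hΛ i j).trans (coeff_zero_grenet_repr e i j)
  have hrow : ∀ j, Λ i₀ j = 0 := fun j => by
    rw [hG, hi₀, if_neg (grenet_col_ne_empty e j).symm, mul_zero]
  have hcol : ∀ i, Λ i j₀ = 0 := fun i => by
    rw [hG, hj₀, if_neg (grenet_row_ne_univ e i), mul_zero]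
  have hGtG : Λᵀ * Λ = 1 - Matrix.single j₀ j₀ 1 :=
    transpose_mul_self_of_signedMatching _ _ hRinj hCinj _ hε j₀
      (fun i => by rw [hj₀]; exact grenet_row_ne_univ e i)
      (fun j hj => exists_grenet_row_eq e fun h => hj (hCinj (h.trans hj₀.symm))) Λ hG
  have hGGt : Λ * Λᵀ = 1 - Matrix.single i₀ i₀ 1 :=
    self_mul_transpose_of_signedMatching _ _ hRinj hCinj _ hε i₀
      (fun j => by rw [hi₀]; exact grenet_col_ne_empty e j)
      (fun i hi => exists_grenet_col_eq e fun h => hi (hRinj (h.trans hi₀.symm))) Λ hG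
  -- steps 3–4: the corank-one gauge lemma
  exact exists_traceBalanced_gauge_of_trace_adjugate_mul_eq_zero Λ Λ' i₀ j₀ hrow hcol hGtG hGGt htr0

end Grenet

end Summit.ValiantsHypothesis.Theorems.RigidityForcesSymmetry.GrenetGauge
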